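import Summits.QuantumFields.BalabanUV.Beta.GAN24.LegTowerMemberRows

/-!
# `BalabanUV.Beta.GAN24.LegTowerWindowDriftSources` — binder row G-an2-4 ∕ (CONV-C), W-slot, the (α-0) parity re-cut, row L11 (Q-L): **THE DRIFT SOCKET's
# WINDOW-SOURCE ROW (H2d) UNPACKED — AT A THIRD RATE, WITH COMPOSITE KERNEL-DRIFT WINDOWS** (G-an2-4 formalisation swarm, leaf prover
# `b2b-balaban-gan24-formalise-leaf-03`, gen 68; FILE 2 (v2) of the journal INTENT [LEAF03-G68-ONLINE] «(H2) ⟸ THE SAME WINDOWS» + A-3's located rate ledger; the drift twin of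
# FILE 1 `GAN24/LegTowerWindowSources`; continues MY `GAN24/TowerRateSlavedSocket` (gen 67, FILE 4a) ∕ `GAN24/LegTowerSlavedDriftRows` (FILE 4b) ∕ `GAN24/LegTowerMemberRows`
# (FILE 8a); imports the TREE-BUILT `GAN24.LegTowerMemberRows` only — FILE 1's olean is not yet served by the farm, so the finite-sum step is done inline)

NOT IN PRINT; OUR BOOKKEEPING ([folklore] window bookkeeping BY NAME; 0 `def`, 0 cited facts, 0 `def … : Prop`, 0 sorry).  HONEST FRAMING (cell contract,
verbatim): «discharging `BetaPertH` makes Bałaban's UV stability UNCONDITIONAL — a real constructive-QFT result; it is NOT the continuum limit and NOT the Clay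
problem.»  HONEST DEPENDENCY (verbatim): «continuum YM on T⁴ ⇐ BetaPertH ∧ nine spine estimates (0/9 proved); BetaPertH ⇐ (D1) ∧ (D4) ∧ CAP+tail; G-an2-4
gates asym, D1 and NE2/3/4.»

WHY.  The drift twin of the (Q-L) END (MY `LegTowerSlavedDriftRows.good_rdiv_towerDiff_of_window_slaved` ∕ `LegTowerMemberRows.…_mem`) displays (H2d), VERBATIM
`∀ n, Good (Σ_{m<k₀} transport (legStepB kc K N) (n+m+2) (k₀−1−m) ((legStepB kc K N (n+m+1) − legStepB kc K N (n+m)) (Δ (n+m)) + (rdiv ∘ F (n+m+1) − rdiv ∘ F (n+m))))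
(s·μ^n)`: the difference tower's sources — the KERNEL-DRIFT letter (consecutive step maps read on the same member) plus the SOURCE-DRIFT letter — pushed through
`k₀−1−m` leg steps from level `n+m+2`.  RATE LEDGER (A-3 of the INTENT): every application of the window theorem (leaf-01 g74's
`locStencil₂_legChain_bsumPow_of_dressed_envelopes{,_of_blockL1}`) costs the packaging factor `108(d+1)∕N^{len}` in the rate ONCE; a member only has the tower's rate `δ`, so the
one-step kernel-drift letter on a member CANNOT come back at rate `δ`.  What the window theorem DOES supply: (i) the difference tower run at a THIRD, smaller rate (size
predicates `GoodD`∕`GoodLD`); (ii) each summand's kernel-drift part as ONE COMPOSITE WINDOW «difference step at `l+1` on the member, then the `q` further steps from `l+2`»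
of length `q+1` from the member's sizes (`Good`, `GoodL`) into `GoodD` — (H1Δw); (iii) the source-drift part as a short window from the sources' own sizes (`GoodS`, `GoodLS`)
into `GoodD` — (HwD); (iv) the difference tower's own k₀-window (H1♮)_D in `GoodD` (no loss).  (H2d) disappears from the display.
WHAT.
* §1 ABSTRACT (`E` an additive commutative group; `GoodD` subadditive ∕ monotone with `GoodD 0 0`; `Good`, `GoodL`, `GoodS`, `GoodLS`, `GoodLD`, `P` arbitrary;
  transports `T p q` additive on `P` (`hTadd`), one-step maps `A l`, a tower `x`, sources `src`): **`good_windowDriftSources`** — IF (HwD) `q < k₀ → P X → GoodS X c →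
  GoodLS X g → GoodD (T p q X) (A·c + B·g)`, (H1Δw) `q < k₀ → P X → Good X c → GoodL X g → GoodD (T (l+2) q (A (l+1) X − A l X)) ((A_Δ·c + B_Δ·g)·ν^l)` (`0 ≤ ν ≤ 1`),
  member rows (Hx) `Good (x l) C_x`, (HxL) `GoodL (x l) σ`, (HxP) `P (x l)`, (HKP) `P (A (l+1) (x l) − A l (x l))`, source-drift rows (HS′) `GoodS (src (l+1) − src l)
  (C_F′·ν^l)`, (HSL′) `GoodLS (src (l+1) − src l) (g_F′·ν^l)`, (HSP′) `P (src (l+1) − src l)`, THEN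
  `∀ n, GoodD (Σ_{m<k₀} T (n+m+2) (k₀−1−m) ((A (n+m+1) (x (n+m)) − A (n+m) (x (n+m))) + (src (n+m+1) − src (n+m)))) ((k₀·(A_Δ·C_x + B_Δ·σ + A·C_F′ + B·g_F′))·ν^n)` —
  (H2d) with `μ := ν`; **`good_towerDiff_rate_of_windows_slaved`** — MY FILE 4a's `good_tower_rate_of_kfold_slaved` on `n ↦ x (n+1) − x n` in `GoodD` currency with (H2d)
  DISCHARGED: (H1♮)_D (every start) ∧ (HwD) ∧ (H1Δw) ∧ member ∕ source-drift rows ∧ (H0d) ∧ (H3d) ⟹ `∃ c ϑ, 0 ≤ c ∧ 0 < ϑ < 1 ∧ ∀ n, GoodD (x (n+1) − x n) (c·ϑ^n)`.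
* §2 THE LEG TOWER (g60's objects; direct membership as in FILE 8a; transport additivity by leaf-01's `transport_add` ⨾ MY g60 `legStepB_add` on bounded tables):
  **`good_rdiv_towerDiff_of_windows_slaved_mem`** — (H1Δw) in CHAIN form `q < k₀ → P W → bounded W → Good W c → GoodL W g →
  GoodD (legChain kc K N (l+2) q (fun s ↦ bsumPow N q ((legStepB kc K N (l+1) W − legStepB kc K N l W) s))) ((A_Δ·c + B_Δ·g)·ν^l)`.
* §3 THE DRESSED COMB TOWER with a fixed root, `LocStencil₂` currency at THREE rates (members `δ`, sources `δS`, differences `δD`), from the affine recursion: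
  **`locStencil₂_rdiv_towerDiff_of_windows_slaved_comb_mem`**.
All rows are DISPLAYED, not discharged ((H1♮)_D ∕ (HwD) ∕ (H1Δw): the window theorem at rate `δD` ∕ from `δS` ∕ composite from `δ` + the OWNER's block-ℓ¹ parts + his part 5
«dressed-kernel-difference envelopes» + `LegWindowArithmetic`; (HKP)∕(HSP′): FILE 3; (HS′)(HSL′): source-drift letter rows; (H3d): the slaved charges' drift).  Asserts NO
bound on any chain; discharges NOTHING of (Q-L) ∕ (C) ∕ «T2Shape» ∕ «T2Drift» ∕ (hW, hWall); NEVER «G-an2-4 closed» as (CONV-C); NOT D1, NOT `BetaPertH`, NOT continuum, NOT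
Clay; not in print.  Unit `b2b-balaban-gan24-formalise-leaf-03` (gen 68), 2026-08-23.
-/

noncomputable section
open Finset
open scoped BigOperators
open Literature.MathematicalPhysics.QuantumFieldTheory
open Literature.MathematicalPhysics.QuantumFieldTheory.Balaban1983to89
open Literature.MathematicalPhysics.QuantumFieldTheory.Balaban1983to89.Beta
open ExpKernelCalculus (MKer Site Decays)
open OneStepResolventKernel (Fib)
open OneStepKernelFamily (KInvStep)
open AffineAveraging (box toSite)
open BalabanCompositeJets (LocStencil₂)
open Summit.QuantumFields.BalabanUV.Beta.GAN24.T2RecursionAffine (lin4)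
open Summit.QuantumFields.BalabanUV.Beta.HessKerDressedUnits (unitK decays_unitK)
open Summit.QuantumFields.BalabanUV.Beta.GAN24.CombesThomas (sfStep smStep)
open Summit.QuantumFields.BalabanUV.Beta.AxialDressingRooted (coDressKBmAt one_le_of_neZero decays_coDressKBmAt_KInvStep)
open Summit.QuantumFields.BalabanUV.Beta.GAN24.Lin4SlotDivergence (hH_unitK_comb)
open Summit.QuantumFields.BalabanUV.Beta.GAN24.Lin4LegDivergence (hM_unitK_comb)
open Summit.QuantumFields.BalabanUV.Beta.GAN24.Lin4LegTower (rdiv bsum legStep rdiv_lin4_affine)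
open Summit.QuantumFields.BalabanUV.Beta.GAN24.Lin4LegTowerUnroll (legStepB bsumPow legChain transport_legStepB_eq bddTab_rdiv bddTab_legStepB legStepB_add)
open Summit.QuantumFields.BalabanUV.Beta.GAN24.AffineUnroll (transport transport_add)
open Summit.QuantumFields.BalabanUV.Beta.GAN24.T2UnitSplitLevels (bdd₄_add bdd₄_sub)
open Summit.QuantumFields.BalabanUV.Beta.GAN24.WSlotT2OfPieces (locStencil₂_zero locStencil₂_add locStencil₂_mono)
open Summit.QuantumFields.BalabanUV.Beta.GAN24.TowerRateSlavedSocket (good_tower_rate_of_kfold_slaved)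
open Summit.QuantumFields.BalabanUV.Beta.GAN24.LegTowerSlavedDriftRows (rdiv_towerDiff_window)

namespace Summit.QuantumFields.BalabanUV.Beta.GAN24.LegTowerWindowDriftSources

/-! ## §1 Abstract: the drift window-source row (H2d) from composite kernel-drift windows, short source windows, and the member ∕ source-drift rows -/

section Abstract

variable {E : Type*}

/-- NOT IN PRINT; OUR BOOKKEEPING.  **THE DRIFT WINDOW-SOURCE ROW (H2d), AT A THIRD SIZE, FROM COMPOSITE KERNEL-DRIFT WINDOWS AND SHORT SOURCE WINDOWS.**  Data:
transports `T p q` ADDITIVE on the class `P` (`hTadd`), one-step maps `A l`, a tower `x`, sources `src`; size predicates: `GoodD` (the differences' size: subadditive ∕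
monotone with `GoodD 0 0`), `Good`∕`GoodL` (the members' sizes), `GoodS`∕`GoodLS` (the sources' sizes) — all but `GoodD` arbitrary.  IF
(HwD) `q < k₀ → P X → GoodS X c → GoodLS X g → GoodD (T p q X) (A·c + B·g)` — the SHORT WINDOWS from the sources' sizes (`0 ≤ A, B`);
(H1Δw) `q < k₀ → P X → Good X c → GoodL X g → GoodD (T (l+2) q (A (l+1) X − A l X)) ((A_Δ·c + B_Δ·g)·ν^l)` — THE COMPOSITE KERNEL-DRIFT WINDOWS from the members' sizes
(`0 ≤ A_Δ, B_Δ`, `0 ≤ ν ≤ 1`);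
(Hx) `Good (x l) C_x`, (HxL) `GoodL (x l) σ`, (HxP) `P (x l)`, (HKP) `P (A (l+1) (x l) − A l (x l))` — the member rows;
(HS′) `GoodS (src (l+1) − src l) (C_F′·ν^l)`, (HSL′) `GoodLS (src (l+1) − src l) (g_F′·ν^l)`, (HSP′) `P (src (l+1) − src l)` — the source-drift rows;
THEN `GoodD (Σ_{m<k₀} T (n+m+2) (k₀−1−m) ((A (n+m+1) (x (n+m)) − A (n+m) (x (n+m))) + (src (n+m+1) − src (n+m)))) ((k₀·(A_Δ·C_x + B_Δ·σ + A·C_F′ + B·g_F′))·ν^n)` for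
EVERY `n` — (H2d) with `μ := ν`. -/
theorem good_windowDriftSources [AddCommGroup E] {Good GoodL GoodS GoodLS GoodD : E → ℝ → Prop} {P : E → Prop}
    (hGDadd : ∀ X Y c c', GoodD X c → GoodD Y c' → GoodD (X + Y) (c + c')) (hGDmono : ∀ X c c', c ≤ c' → GoodD X c → GoodD X c') (hGD0 : GoodD 0 0)
    {T : ℕ → ℕ → E → E} {Astep : ℕ → E → E} {x src : ℕ → E} {k₀ : ℕ} {A B AΔ BΔ Cx σ CF' gF' ν : ℝ}
    (hA : 0 ≤ A) (hB : 0 ≤ B) (hAΔ : 0 ≤ AΔ) (hBΔ : 0 ≤ BΔ) (hCx : 0 ≤ Cx) (hσ : 0 ≤ σ) (hCF' : 0 ≤ CF') (hgF' : 0 ≤ gF')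
    (hν0 : 0 ≤ ν) (hν1 : ν ≤ 1)
    (hTadd : ∀ (p q : ℕ) (X Y : E), P X → P Y → T p q (X + Y) = T p q X + T p q Y)
    (HwD : ∀ (p q : ℕ) (X : E) (c g : ℝ), q < k₀ → P X → GoodS X c → GoodLS X g → GoodD (T p q X) (A * c + B * g))
    (HΔw : ∀ (l q : ℕ) (X : E) (c g : ℝ), q < k₀ → P X → Good X c → GoodL X g →
      GoodD (T (l + 2) q (Astep (l + 1) X - Astep l X)) ((AΔ * c + BΔ * g) * ν ^ l))
    (Hx : ∀ l, Good (x l) Cx) (HxL : ∀ l, GoodL (x l) σ) (HxP : ∀ l, P (x l)) (HKP : ∀ l, P (Astep (l + 1) (x l) - Astep l (x l)))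
    (HS' : ∀ l, GoodS (src (l + 1) - src l) (CF' * ν ^ l)) (HSL' : ∀ l, GoodLS (src (l + 1) - src l) (gF' * ν ^ l)) (HSP' : ∀ l, P (src (l + 1) - src l))
    (n : ℕ) :
    GoodD (∑ m ∈ Finset.range k₀, T (n + m + 2) (k₀ - 1 - m) ((Astep (n + m + 1) (x (n + m)) - Astep (n + m) (x (n + m))) + (src (n + m + 1) - src (n + m))))
      ((k₀ * (AΔ * Cx + BΔ * σ + A * CF' + B * gF')) * ν ^ n) := by
  have hKn : 0 ≤ AΔ * Cx + BΔ * σ + A * CF' + B * gF' := by positivity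
  have hterm : ∀ m ∈ Finset.range k₀, GoodD (T (n + m + 2) (k₀ - 1 - m)
      ((Astep (n + m + 1) (x (n + m)) - Astep (n + m) (x (n + m))) + (src (n + m + 1) - src (n + m)))) ((AΔ * Cx + BΔ * σ + A * CF' + B * gF') * ν ^ n) := by
    intro m hm
    have hq : k₀ - 1 - m < k₀ := by have := Finset.mem_range.mp hm; omega
    -- split the transport of the difference source (additivity on the class), then: composite kernel-drift window + short source window
    rw [hTadd _ _ _ _ (HKP (n + m)) (HSP' (n + m))]
    refine hGDmono _ _ _ ?_ (hGDadd _ _ _ _ (HΔw (n + m) (k₀ - 1 - m) (x (n + m)) Cx σ hq (HxP _) (Hx _) (HxL _))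
      (HwD (n + m + 2) (k₀ - 1 - m) _ _ _ hq (HSP' (n + m)) (HS' (n + m)) (HSL' (n + m))))
    have hνpow : ν ^ (n + m) ≤ ν ^ n := pow_le_pow_of_le_one hν0 hν1 (Nat.le_add_right n m)
    calc (AΔ * Cx + BΔ * σ) * ν ^ (n + m) + (A * (CF' * ν ^ (n + m)) + B * (gF' * ν ^ (n + m)))
        = (AΔ * Cx + BΔ * σ + A * CF' + B * gF') * ν ^ (n + m) := by ring
      _ ≤ (AΔ * Cx + BΔ * σ + A * CF' + B * gF') * ν ^ n := mul_le_mul_of_nonneg_left hνpow hKn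
  -- a finite sum of `GoodD` elements (the two-line induction of FILE 1's `good_finset_sum`, inline)
  have hsum : ∀ (f : ℕ → E) (c : ℝ) (s : Finset ℕ), (∀ m ∈ s, GoodD (f m) c) → GoodD (∑ m ∈ s, f m) (∑ _m ∈ s, c) := by
    intro f c s h
    classical
    induction s using Finset.induction_on with
    | empty => simpa only [Finset.sum_empty] using hGD0
    | insert i s hi ih =>
      rw [Finset.sum_insert hi, Finset.sum_insert hi]
      exact hGDadd _ _ _ _ (h i (Finset.mem_insert_self i s)) (ih fun j hj => h j (Finset.mem_insert_of_mem hj))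
  have h := hsum
    (fun m => T (n + m + 2) (k₀ - 1 - m) ((Astep (n + m + 1) (x (n + m)) - Astep (n + m) (x (n + m))) + (src (n + m + 1) - src (n + m))))
    ((AΔ * Cx + BΔ * σ + A * CF' + B * gF') * ν ^ n) (Finset.range k₀) hterm
  rw [Finset.sum_const, Finset.card_range, nsmul_eq_mul] at h
  exact hGDmono _ _ _ (le_of_eq (by ring)) h

/-- NOT IN PRINT; OUR BOOKKEEPING.  **THE DIFFERENCE TOWER's RATE SOCKET, AT A THIRD SIZE, WITH (H2d) DISCHARGED** (= MY FILE 4a's `good_tower_rate_of_kfold_slaved` on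
`n ↦ x (n+1) − x n` in the `GoodD`∕`GoodLD` currency with (H2d) ⟸ `good_windowDriftSources`).  The difference tower has the k₀-window form
`x (n+k₀+1) − x (n+k₀) = T (n+1) k₀ (x (n+1) − x n) + Σ_{m<k₀} T (n+m+2) (k₀−1−m) (…)` (`hwin`) and its members lie in `P` (`hdP`).  IF
(H1♮)_D `P X → GoodD X c → GoodLD X g → GoodD (T p k₀ X) (θ·c + Cg·g)` (EVERY start `p`; `0 ≤ θ < 1`) — the k₀-window in the differences' size; (HwD); (H1Δw) (`0 ≤ ν < 1`);
(Hx)(HxL)(HxP)(HKP); (HS′)(HSL′)(HSP′); (H0d) `GoodD (x (i+1) − x i) M` for `i < k₀`; (H3d) `GoodLD (x (n+1) − x n) (σ_d·ν^n)`;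
THEN `∃ c ϑ, 0 ≤ c ∧ 0 < ϑ < 1 ∧ ∀ n, GoodD (x (n+1) − x n) (c·ϑ^n)`.  Nothing of the displayed rows is claimed. -/
theorem good_towerDiff_rate_of_windows_slaved [AddCommGroup E] {Good GoodL GoodS GoodLS GoodD GoodLD : E → ℝ → Prop} {P : E → Prop}
    (hGDadd : ∀ X Y c c', GoodD X c → GoodD Y c' → GoodD (X + Y) (c + c')) (hGDmono : ∀ X c c', c ≤ c' → GoodD X c → GoodD X c') (hGD0 : GoodD 0 0)
    {T : ℕ → ℕ → E → E} {Astep : ℕ → E → E} {x src : ℕ → E} {k₀ : ℕ} (hk : 0 < k₀)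
    (hwin : ∀ n, x (n + k₀ + 1) - x (n + k₀) = T (n + 1) k₀ (x (n + 1) - x n)
      + ∑ m ∈ Finset.range k₀, T (n + m + 2) (k₀ - 1 - m) ((Astep (n + m + 1) (x (n + m)) - Astep (n + m) (x (n + m))) + (src (n + m + 1) - src (n + m))))
    (hdP : ∀ n, P (x (n + 1) - x n))
    {θ Cg A B AΔ BΔ Cx σ CF' gF' ν M σd : ℝ} (hθ0 : 0 ≤ θ) (hθ1 : θ < 1) (hCg : 0 ≤ Cg) (hA : 0 ≤ A) (hB : 0 ≤ B) (hAΔ : 0 ≤ AΔ) (hBΔ : 0 ≤ BΔ)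
    (hCx : 0 ≤ Cx) (hσ : 0 ≤ σ) (hCF' : 0 ≤ CF') (hgF' : 0 ≤ gF') (hν0 : 0 ≤ ν) (hν1 : ν < 1) (hM : 0 ≤ M) (hσd : 0 ≤ σd)
    (hTadd : ∀ (p q : ℕ) (X Y : E), P X → P Y → T p q (X + Y) = T p q X + T p q Y)
    (H1 : ∀ (p : ℕ) (X : E) (c g : ℝ), P X → GoodD X c → GoodLD X g → GoodD (T p k₀ X) (θ * c + Cg * g))
    (HwD : ∀ (p q : ℕ) (X : E) (c g : ℝ), q < k₀ → P X → GoodS X c → GoodLS X g → GoodD (T p q X) (A * c + B * g))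
    (HΔw : ∀ (l q : ℕ) (X : E) (c g : ℝ), q < k₀ → P X → Good X c → GoodL X g →
      GoodD (T (l + 2) q (Astep (l + 1) X - Astep l X)) ((AΔ * c + BΔ * g) * ν ^ l))
    (Hx : ∀ l, Good (x l) Cx) (HxL : ∀ l, GoodL (x l) σ) (HxP : ∀ l, P (x l)) (HKP : ∀ l, P (Astep (l + 1) (x l) - Astep l (x l)))
    (HS' : ∀ l, GoodS (src (l + 1) - src l) (CF' * ν ^ l)) (HSL' : ∀ l, GoodLS (src (l + 1) - src l) (gF' * ν ^ l)) (HSP' : ∀ l, P (src (l + 1) - src l))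
    (H0 : ∀ i, i < k₀ → GoodD (x (i + 1) - x i) M) (H3 : ∀ n, GoodLD (x (n + 1) - x n) (σd * ν ^ n)) :
    ∃ c ϑ : ℝ, 0 ≤ c ∧ 0 < ϑ ∧ ϑ < 1 ∧ ∀ n, GoodD (x (n + 1) - x n) (c * ϑ ^ n) :=
  good_tower_rate_of_kfold_slaved (Good := GoodD) (GoodL := GoodLD) (P := P) (x := fun n => x (n + 1) - x n) (Φ := fun n X => T (n + 1) k₀ X)
    (S := fun n => ∑ m ∈ Finset.range k₀, T (n + m + 2) (k₀ - 1 - m) ((Astep (n + m + 1) (x (n + m)) - Astep (n + m) (x (n + m))) + (src (n + m + 1) - src (n + m))))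
    hGDadd hGDmono hk hwin hdP hθ0 hθ1 hCg (by positivity : (0 : ℝ) ≤ k₀ * (AΔ * Cx + BΔ * σ + A * CF' + B * gF')) hM hσd hν0 hν1
    (fun n X c g hX hc hg => H1 (n + 1) X c g hX hc hg)
    (fun n => good_windowDriftSources hGDadd hGDmono hGD0 hA hB hAΔ hBΔ hCx hσ hCF' hgF' hν0 hν1.le hTadd HwD HΔw Hx HxL HxP HKP HS' HSL' HSP' n) H0 H3

end Abstract

/-! ## §2 The right-divergenced leg tower: the drift END at a third size with (H2d) discharged, direct membership -/

section Leg

variable {d : ℕ} {N : ℕ} {kc : ℕ → ℝ} {K : ℕ → MKer (d + 1) (Fib d)}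
  {T F : ℕ → (Fin (d + 1) → (Fin (d + 1) → ℤ) → Fin (d + 1) → (Fin (d + 1) → ℤ) → MKer (d + 1) (Fib d))}

/-- NOT IN PRINT; OUR BOOKKEEPING.  **THE DRIFT TWIN OF THE (Q-L) END AT A THIRD SIZE, (H2d) DISCHARGED, DIRECT MEMBERSHIP** (`Δ n := fun s ↦ rdiv (T n s)` under g60's
closed one-step law; kernels decay, members and sources bounded; `GoodD` subadditive ∕ monotone with `GoodD 0 0`; `Good`, `GoodL`, `GoodS`, `GoodLS`, `GoodLD` arbitrary;
IN THE CLASS `P`: the differences `hDP`, the members `hxP`, the kernel-drift letters `hKP`, the source-drift letters `hSP`; the transports are additive on bounded tables by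
leaf-01's `transport_add` ⨾ MY g60 `legStepB_add`).  IF
(H1♮)_D for every level `n` and bounded `W ∈ P`: `GoodD W c → GoodLD W g → GoodD (legChain kc K N n k₀ (𝔹^{k₀} W)) (θ·c + Cg·g)`;
(HwD) for every start `p`, length `q < k₀`, bounded `W ∈ P`: `GoodS W c → GoodLS W g → GoodD (legChain kc K N p q (𝔹^q W)) (A·c + B·g)`;
(H1Δw) THE COMPOSITE KERNEL-DRIFT WINDOWS: for every level `l`, length `q < k₀`, bounded `W ∈ P`: `Good W c → GoodL W g →
GoodD (legChain kc K N (l+2) q (𝔹^q (legStepB kc K N (l+1) W − legStepB kc K N l W))) ((A_Δ·c + B_Δ·g)·ν^l)` (`0 ≤ ν < 1`);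
(Hx) `Good (Δ l) C_x`, (H3) `GoodL (Δ l) σ`; (HS′) `GoodS (rdiv ∘ F (l+1) − rdiv ∘ F l) (C_F′·ν^l)`, (HSL′) `GoodLS (…) (g_F′·ν^l)`;
(H0d) `GoodD (Δ (i+1) − Δ i) M` on the first window; (H3d) `GoodLD (Δ (n+1) − Δ n) (σ_d·ν^n)`;
THEN `∃ c ϑ, 0 ≤ c ∧ 0 < ϑ < 1 ∧ ∀ n, GoodD (Δ (n+1) − Δ n) (c·ϑ^n)`.  Nothing of the displayed rows is claimed. -/
theorem good_rdiv_towerDiff_of_windows_slaved_mem (hK : ∀ m, ∃ δ C : ℝ, 0 < δ ∧ Decays (K m) C δ)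
    (hT : ∀ m, ∃ B : ℝ, ∀ κ u κ' u' x z a b, |T m κ u κ' u' x z a b| ≤ B) (hF : ∀ m, ∃ B : ℝ, ∀ κ u κ' u' x z a b, |F m κ u κ' u' x z a b| ≤ B)
    (hstep : ∀ m κ u κ' u', rdiv (T (m + 1) κ u κ' u')
      = legStep (kc m) (K m) (K m) N (fun κ u κ' u' => bsum N (rdiv (T m κ u κ' u'))) κ u κ' u' + rdiv (F m κ u κ' u'))
    (P : (Fin (d + 1) → (Fin (d + 1) → ℤ) → Fin (d + 1) → (Fin (d + 1) → ℤ) → MKer (d + 1) (Fib d)) → Prop)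
    (hDP : ∀ n, P ((fun κ u κ' u' => rdiv (T (n + 1) κ u κ' u')) - (fun κ u κ' u' => rdiv (T n κ u κ' u'))))
    (hxP : ∀ n, P (fun κ u κ' u' => rdiv (T n κ u κ' u')))
    (hKP : ∀ l, P (legStepB kc K N (l + 1) (fun κ u κ' u' => rdiv (T l κ u κ' u')) - legStepB kc K N l (fun κ u κ' u' => rdiv (T l κ u κ' u'))))
    (hSP : ∀ l, P ((fun κ u κ' u' => rdiv (F (l + 1) κ u κ' u')) - (fun κ u κ' u' => rdiv (F l κ u κ' u'))))
    {Good GoodL GoodS GoodLS GoodD GoodLD : (Fin (d + 1) → (Fin (d + 1) → ℤ) → Fin (d + 1) → (Fin (d + 1) → ℤ) → MKer (d + 1) (Fib d)) → ℝ → Prop}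
    (hGDadd : ∀ X Y c c', GoodD X c → GoodD Y c' → GoodD (X + Y) (c + c')) (hGDmono : ∀ X c c', c ≤ c' → GoodD X c → GoodD X c') (hGD0 : GoodD 0 0)
    {k₀ : ℕ} (hk : 0 < k₀) {θ Cg A B AΔ BΔ Cx σ CF' gF' ν M σd : ℝ} (hθ0 : 0 ≤ θ) (hθ1 : θ < 1) (hCg : 0 ≤ Cg) (hA : 0 ≤ A) (hB : 0 ≤ B)
    (hAΔ : 0 ≤ AΔ) (hBΔ : 0 ≤ BΔ) (hCx : 0 ≤ Cx) (hσ : 0 ≤ σ) (hCF' : 0 ≤ CF') (hgF' : 0 ≤ gF') (hν0 : 0 ≤ ν) (hν1 : ν < 1) (hM : 0 ≤ M) (hσd : 0 ≤ σd)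
    (H1 : ∀ n (W : (Fin (d + 1) → (Fin (d + 1) → ℤ) → Fin (d + 1) → (Fin (d + 1) → ℤ) → MKer (d + 1) (Fib d))) (c g : ℝ), P W →
      (∃ B : ℝ, ∀ κ u κ' u' x z a b, |W κ u κ' u' x z a b| ≤ B) → GoodD W c → GoodLD W g →
        GoodD (legChain kc K N n k₀ (fun κ u κ' u' => bsumPow N k₀ (W κ u κ' u'))) (θ * c + Cg * g))
    (HwD : ∀ p q (W : (Fin (d + 1) → (Fin (d + 1) → ℤ) → Fin (d + 1) → (Fin (d + 1) → ℤ) → MKer (d + 1) (Fib d))) (c g : ℝ), q < k₀ → P W →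
      (∃ B : ℝ, ∀ κ u κ' u' x z a b, |W κ u κ' u' x z a b| ≤ B) → GoodS W c → GoodLS W g →
        GoodD (legChain kc K N p q (fun κ u κ' u' => bsumPow N q (W κ u κ' u'))) (A * c + B * g))
    (HΔw : ∀ l q (W : (Fin (d + 1) → (Fin (d + 1) → ℤ) → Fin (d + 1) → (Fin (d + 1) → ℤ) → MKer (d + 1) (Fib d))) (c g : ℝ), q < k₀ → P W →
      (∃ B : ℝ, ∀ κ u κ' u' x z a b, |W κ u κ' u' x z a b| ≤ B) → Good W c → GoodL W g →
        GoodD (legChain kc K N (l + 2) q (fun κ u κ' u' => bsumPow N q ((legStepB kc K N (l + 1) W - legStepB kc K N l W) κ u κ' u')))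
          ((AΔ * c + BΔ * g) * ν ^ l))
    (Hx : ∀ l, Good (fun κ u κ' u' => rdiv (T l κ u κ' u')) Cx) (H3 : ∀ l, GoodL (fun κ u κ' u' => rdiv (T l κ u κ' u')) σ)
    (HS' : ∀ l, GoodS ((fun κ u κ' u' => rdiv (F (l + 1) κ u κ' u')) - (fun κ u κ' u' => rdiv (F l κ u κ' u'))) (CF' * ν ^ l))
    (HSL' : ∀ l, GoodLS ((fun κ u κ' u' => rdiv (F (l + 1) κ u κ' u')) - (fun κ u κ' u' => rdiv (F l κ u κ' u'))) (gF' * ν ^ l))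
    (H0 : ∀ i, i < k₀ → GoodD ((fun κ u κ' u' => rdiv (T (i + 1) κ u κ' u')) - (fun κ u κ' u' => rdiv (T i κ u κ' u'))) M)
    (H3d : ∀ n, GoodLD ((fun κ u κ' u' => rdiv (T (n + 1) κ u κ' u')) - (fun κ u κ' u' => rdiv (T n κ u κ' u'))) (σd * ν ^ n)) :
    ∃ c ϑ : ℝ, 0 ≤ c ∧ 0 < ϑ ∧ ϑ < 1 ∧
      ∀ n, GoodD ((fun κ u κ' u' => rdiv (T (n + 1) κ u κ' u')) - (fun κ u κ' u' => rdiv (T n κ u κ' u'))) (c * ϑ ^ n) := by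
  have hPadd : ∀ (p q : ℕ) (X Y : (Fin (d + 1) → (Fin (d + 1) → ℤ) → Fin (d + 1) → (Fin (d + 1) → ℤ) → MKer (d + 1) (Fib d))),
      (P X ∧ ∃ B : ℝ, ∀ κ u κ' u' x z a b, |X κ u κ' u' x z a b| ≤ B) → (P Y ∧ ∃ B : ℝ, ∀ κ u κ' u' x z a b, |Y κ u κ' u' x z a b| ≤ B) →
      transport (legStepB kc K N) p q (X + Y) = transport (legStepB kc K N) p q X + transport (legStepB kc K N) p q Y :=
    fun p q X Y hX hY => transport_add (A := legStepB kc K N)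
      (P := fun W : (Fin (d + 1) → (Fin (d + 1) → ℤ) → Fin (d + 1) → (Fin (d + 1) → ℤ) → MKer (d + 1) (Fib d)) => ∃ B : ℝ, ∀ κ u κ' u' x z a b, |W κ u κ' u' x z a b| ≤ B)
      (fun j _ hW => bddTab_legStepB hK j hW) (fun j _ _ hX hY => legStepB_add hK j hX hY) p q hX.2 hY.2
  refine good_towerDiff_rate_of_windows_slaved (Good := Good) (GoodL := GoodL) (GoodS := GoodS) (GoodLS := GoodLS) (GoodD := GoodD) (GoodLD := GoodLD)
    (P := fun W => P W ∧ ∃ B : ℝ, ∀ κ u κ' u' x z a b, |W κ u κ' u' x z a b| ≤ B)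
    (x := fun n => (fun κ u κ' u' => rdiv (T n κ u κ' u'))) (T := fun p q W => transport (legStepB kc K N) p q W) (Astep := legStepB kc K N)
    (src := fun m => (fun κ u κ' u' => rdiv (F m κ u κ' u')))
    hGDadd hGDmono hGD0 hk (fun m => rdiv_towerDiff_window hK hT hF hstep m k₀)
    (fun n => ⟨hDP n, bdd₄_sub (bddTab_rdiv (hT (n + 1))) (bddTab_rdiv (hT n))⟩)
    hθ0 hθ1 hCg hA hB hAΔ hBΔ hCx hσ hCF' hgF' hν0 hν1 hM hσd hPadd
    (fun p W c g hW hc hg => ?_) (fun p q W c g hq hW hc hg => ?_) (fun l q W c g hq hW hc hg => ?_)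
    Hx H3 (fun l => ⟨hxP l, bddTab_rdiv (hT l)⟩)
    (fun l => ⟨hKP l, bdd₄_sub (bddTab_legStepB hK (l + 1) (bddTab_rdiv (hT l))) (bddTab_legStepB hK l (bddTab_rdiv (hT l)))⟩)
    HS' HSL' (fun l => ⟨hSP l, bdd₄_sub (bddTab_rdiv (hF (l + 1))) (bddTab_rdiv (hF l))⟩) H0 H3d
  · show GoodD (transport (legStepB kc K N) p k₀ W) (θ * c + Cg * g)
    rw [transport_legStepB_eq hK p k₀ hW.2]
    exact H1 p W c g hW.1 hW.2 hc hg
  · show GoodD (transport (legStepB kc K N) p q W) (A * c + B * g)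
    rw [transport_legStepB_eq hK p q hW.2]
    exact HwD p q W c g hq hW.1 hW.2 hc hg
  · show GoodD (transport (legStepB kc K N) (l + 2) q (legStepB kc K N (l + 1) W - legStepB kc K N l W)) ((AΔ * c + BΔ * g) * ν ^ l)
    rw [transport_legStepB_eq hK (l + 2) q (bdd₄_sub (bddTab_legStepB hK (l + 1) hW.2) (bddTab_legStepB hK l hW.2))]
    exact HΔw l q W c g hq hW.1 hW.2 hc hg

end Leg

/-! ## §3 The dressed comb tower with a fixed root, `LocStencil₂` currency at three rates, from the affine recursion -/

section Comb

variable {d : ℕ} {Lc : ℕ} [NeZero Lc] {r : Fin (d + 1) → ℕ}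

/-- NOT IN PRINT; OUR BOOKKEEPING.  **THE DRIFT TWIN FOR THE DRESSED COMB TOWER (fixed root), `LocStencil₂` CURRENCY AT THREE RATES, DIRECT MEMBERSHIP, (H2d) DISCHARGED**
(`T (m+1) = lin4 (c m) K♮ᴱ_m Lc (T m) + F m`, `kc m = −(c m·(Lc^{d+1})⁻¹)`; as FILE 8a; members at rate `δ`, sources at rate `δS`, differences at rate `δD`):
`hDP` ∧ `hxP` ∧ `hKP` ∧ `hSP` ∧ (H1♮)_{δD} ∧ (HwD)_{δS → δD} ∧ (H1Δw)_{δ → δD} ∧ (Hx)_δ ∧ (H3) ∧ (HS′)_{δS} ∧ (HSL′) ∧ (H0d)_{δD} ∧ (H3d) ⟹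
`∃ c′ ϑ, 0 ≤ c′ ∧ 0 < ϑ < 1 ∧ ∀ n, LocStencil₂ (rdiv ∘ T (n+1) − rdiv ∘ T n) (c′·ϑ^n) δD`. -/
theorem locStencil₂_rdiv_towerDiff_of_windows_slaved_comb_mem (hr : r ∈ box (d + 1) Lc) (c : ℕ → ℝ)
    {T F : ℕ → (Fin (d + 1) → (Fin (d + 1) → ℤ) → Fin (d + 1) → (Fin (d + 1) → ℤ) → MKer (d + 1) (Fib d))}
    (hT0 : ∃ B : ℝ, ∀ κ u κ' u' x z a b, |T 0 κ u κ' u' x z a b| ≤ B) (hF : ∀ m, ∃ B : ℝ, ∀ κ u κ' u' x z a b, |F m κ u κ' u' x z a b| ≤ B)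
    (hrec : ∀ m, T (m + 1) = lin4 (c m) (unitK (sfStep Lc m) (smStep d Lc m) (coDressKBmAt (toSite r) Lc (KInvStep (d := d) Lc m))) Lc (T m) + F m)
    (P : (Fin (d + 1) → (Fin (d + 1) → ℤ) → Fin (d + 1) → (Fin (d + 1) → ℤ) → MKer (d + 1) (Fib d)) → Prop)
    (hDP : ∀ n, P ((fun κ u κ' u' => rdiv (T (n + 1) κ u κ' u')) - (fun κ u κ' u' => rdiv (T n κ u κ' u'))))
    (hxP : ∀ n, P (fun κ u κ' u' => rdiv (T n κ u κ' u')))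
    (hKP : ∀ l, P (legStepB (fun m => -(c m * ((Lc : ℝ) ^ (d + 1))⁻¹))
          (fun m => unitK (sfStep Lc m) (smStep d Lc m) (coDressKBmAt (toSite r) Lc (KInvStep (d := d) Lc m))) Lc (l + 1) (fun κ u κ' u' => rdiv (T l κ u κ' u'))
        - legStepB (fun m => -(c m * ((Lc : ℝ) ^ (d + 1))⁻¹))
          (fun m => unitK (sfStep Lc m) (smStep d Lc m) (coDressKBmAt (toSite r) Lc (KInvStep (d := d) Lc m))) Lc l (fun κ u κ' u' => rdiv (T l κ u κ' u'))))
    (hSP : ∀ l, P ((fun κ u κ' u' => rdiv (F (l + 1) κ u κ' u')) - (fun κ u κ' u' => rdiv (F l κ u κ' u'))))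
    {GoodL GoodLS GoodLD : (Fin (d + 1) → (Fin (d + 1) → ℤ) → Fin (d + 1) → (Fin (d + 1) → ℤ) → MKer (d + 1) (Fib d)) → ℝ → Prop} (δ δS δD : ℝ)
    {k₀ : ℕ} (hk : 0 < k₀) {θ Cg A B AΔ BΔ Cx σ CF' gF' ν M σd : ℝ} (hθ0 : 0 ≤ θ) (hθ1 : θ < 1) (hCg : 0 ≤ Cg) (hA : 0 ≤ A) (hB : 0 ≤ B)
    (hAΔ : 0 ≤ AΔ) (hBΔ : 0 ≤ BΔ) (hCx : 0 ≤ Cx) (hσ : 0 ≤ σ) (hCF' : 0 ≤ CF') (hgF' : 0 ≤ gF') (hν0 : 0 ≤ ν) (hν1 : ν < 1) (hM : 0 ≤ M) (hσd : 0 ≤ σd)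
    (H1 : ∀ n (W : (Fin (d + 1) → (Fin (d + 1) → ℤ) → Fin (d + 1) → (Fin (d + 1) → ℤ) → MKer (d + 1) (Fib d))) (C g : ℝ), P W →
      (∃ B : ℝ, ∀ κ u κ' u' x z a b, |W κ u κ' u' x z a b| ≤ B) → LocStencil₂ W C δD → GoodLD W g →
        LocStencil₂ (legChain (fun m => -(c m * ((Lc : ℝ) ^ (d + 1))⁻¹))
          (fun m => unitK (sfStep Lc m) (smStep d Lc m) (coDressKBmAt (toSite r) Lc (KInvStep (d := d) Lc m))) Lc n k₀
          (fun κ u κ' u' => bsumPow Lc k₀ (W κ u κ' u'))) (θ * C + Cg * g) δD)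
    (HwD : ∀ p q (W : (Fin (d + 1) → (Fin (d + 1) → ℤ) → Fin (d + 1) → (Fin (d + 1) → ℤ) → MKer (d + 1) (Fib d))) (C g : ℝ), q < k₀ → P W →
      (∃ B : ℝ, ∀ κ u κ' u' x z a b, |W κ u κ' u' x z a b| ≤ B) → LocStencil₂ W C δS → GoodLS W g →
        LocStencil₂ (legChain (fun m => -(c m * ((Lc : ℝ) ^ (d + 1))⁻¹))
          (fun m => unitK (sfStep Lc m) (smStep d Lc m) (coDressKBmAt (toSite r) Lc (KInvStep (d := d) Lc m))) Lc p q
          (fun κ u κ' u' => bsumPow Lc q (W κ u κ' u'))) (A * C + B * g) δD)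
    (HΔw : ∀ l q (W : (Fin (d + 1) → (Fin (d + 1) → ℤ) → Fin (d + 1) → (Fin (d + 1) → ℤ) → MKer (d + 1) (Fib d))) (C g : ℝ), q < k₀ → P W →
      (∃ B : ℝ, ∀ κ u κ' u' x z a b, |W κ u κ' u' x z a b| ≤ B) → LocStencil₂ W C δ → GoodL W g →
        LocStencil₂ (legChain (fun m => -(c m * ((Lc : ℝ) ^ (d + 1))⁻¹))
          (fun m => unitK (sfStep Lc m) (smStep d Lc m) (coDressKBmAt (toSite r) Lc (KInvStep (d := d) Lc m))) Lc (l + 2) q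
          (fun κ u κ' u' => bsumPow Lc q ((legStepB (fun m => -(c m * ((Lc : ℝ) ^ (d + 1))⁻¹))
              (fun m => unitK (sfStep Lc m) (smStep d Lc m) (coDressKBmAt (toSite r) Lc (KInvStep (d := d) Lc m))) Lc (l + 1) W
            - legStepB (fun m => -(c m * ((Lc : ℝ) ^ (d + 1))⁻¹))
              (fun m => unitK (sfStep Lc m) (smStep d Lc m) (coDressKBmAt (toSite r) Lc (KInvStep (d := d) Lc m))) Lc l W) κ u κ' u'))) ((AΔ * C + BΔ * g) * ν ^ l) δD)
    (Hx : ∀ l, LocStencil₂ (fun κ u κ' u' => rdiv (T l κ u κ' u')) Cx δ) (H3 : ∀ l, GoodL (fun κ u κ' u' => rdiv (T l κ u κ' u')) σ)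
    (HS' : ∀ l, LocStencil₂ ((fun κ u κ' u' => rdiv (F (l + 1) κ u κ' u')) - (fun κ u κ' u' => rdiv (F l κ u κ' u'))) (CF' * ν ^ l) δS)
    (HSL' : ∀ l, GoodLS ((fun κ u κ' u' => rdiv (F (l + 1) κ u κ' u')) - (fun κ u κ' u' => rdiv (F l κ u κ' u'))) (gF' * ν ^ l))
    (H0 : ∀ i, i < k₀ → LocStencil₂ ((fun κ u κ' u' => rdiv (T (i + 1) κ u κ' u')) - (fun κ u κ' u' => rdiv (T i κ u κ' u'))) M δD)
    (H3d : ∀ n, GoodLD ((fun κ u κ' u' => rdiv (T (n + 1) κ u κ' u')) - (fun κ u κ' u' => rdiv (T n κ u κ' u'))) (σd * ν ^ n)) :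
    ∃ c' ϑ : ℝ, 0 ≤ c' ∧ 0 < ϑ ∧ ϑ < 1 ∧
      ∀ n, LocStencil₂ ((fun κ u κ' u' => rdiv (T (n + 1) κ u κ' u')) - (fun κ u κ' u' => rdiv (T n κ u κ' u'))) (c' * ϑ ^ n) δD := by
  have hK : ∀ m, ∃ δ C : ℝ, 0 < δ ∧ Decays (unitK (sfStep Lc m) (smStep d Lc m) (coDressKBmAt (toSite r) Lc (KInvStep (d := d) Lc m))) C δ := by
    intro m
    obtain ⟨δK, CK, hδK, -, hG⟩ := decays_coDressKBmAt_KInvStep (d := d) hr m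
    exact ⟨δK, _, hδK, decays_unitK hG⟩
  have hTb : ∀ m, ∃ B : ℝ, ∀ κ u κ' u' x z a b, |T m κ u κ' u' x z a b| ≤ B := by
    intro m
    induction m with
    | zero => exact hT0
    | succ m ih =>
      obtain ⟨δ', C', hδ', hKm⟩ := hK m
      rw [hrec m]
      exact bdd₄_add (Lin4Additive.lin4_bdd hKm hδ' (c m) Lc ih) (hF m)
  have hstep : ∀ m κ u κ' u', rdiv (T (m + 1) κ u κ' u')
      = legStep (-(c m * ((Lc : ℝ) ^ (d + 1))⁻¹)) (unitK (sfStep Lc m) (smStep d Lc m) (coDressKBmAt (toSite r) Lc (KInvStep (d := d) Lc m)))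
          (unitK (sfStep Lc m) (smStep d Lc m) (coDressKBmAt (toSite r) Lc (KInvStep (d := d) Lc m))) Lc
          (fun κ u κ' u' => bsum Lc (rdiv (T m κ u κ' u'))) κ u κ' u' + rdiv (F m κ u κ' u') := by
    intro m κ u κ' u'
    obtain ⟨δ', C', hδ', hKm⟩ := hK m
    obtain ⟨B', hB'⟩ := hTb m
    rw [hrec m]
    exact rdiv_lin4_affine hKm hδ' (one_le_of_neZero Lc) (c m) hB' (hH_unitK_comb hr m) (hM_unitK_comb m) (F m) κ u κ' u'
  exact good_rdiv_towerDiff_of_windows_slaved_mem (N := Lc) (kc := (fun m => -(c m * ((Lc : ℝ) ^ (d + 1))⁻¹)))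
    (K := (fun m => unitK (sfStep Lc m) (smStep d Lc m) (coDressKBmAt (toSite r) Lc (KInvStep (d := d) Lc m)))) hK hTb hF hstep P hDP hxP hKP hSP
    (Good := fun X C => LocStencil₂ X C δ) (GoodL := GoodL) (GoodS := fun X C => LocStencil₂ X C δS) (GoodLS := GoodLS)
    (GoodD := fun X C => LocStencil₂ X C δD) (GoodLD := GoodLD)
    (fun _ _ _ _ hX hY => locStencil₂_add hX hY) (fun _ _ _ hCC hX => locStencil₂_mono hX hCC) (locStencil₂_zero (d := d) δD)
    hk hθ0 hθ1 hCg hA hB hAΔ hBΔ hCx hσ hCF' hgF' hν0 hν1 hM hσd H1 HwD HΔw Hx H3 HS' HSL' H0 H3d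

end Comb

end Summit.QuantumFields.BalabanUV.Beta.GAN24.LegTowerWindowDriftSources
end
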